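import Summits.ABC.IUTFork.Cor312ColumnTransport
import Summits.ABC.IUTFork.Cor312SettingReal
import Summits.ABC.IUTFork.Cor312IndVolumeReal
import HarnessLib

/-!
# [IUTchIII] Cor. 3.12, verbatim form — column change at the GENUINE settings of a real instantiation

Record-only file (D-0012) of the abc-iut cell (WAVE-5 seat abc-iut-w5-d191; kernel form of the rider N2 of
the second-pass audit `HOME/staging/w5/w5-d191/AUDIT-p412212-p411655.md` of TEAM C rows C-3/C-7); TAKES NO
SIDE on [IUTchIII] Cor. 3.12 and asserts none of its hypotheses.

Row C-3 (`Cor312ColumnTransport.lean`, abc-iut-c312-13) TRANSPORTS a `Cor312.Setting` to another column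
along one indeterminacy `Φ` with `S.D n' = (S.D n).map Φ`: hull frames are PUSHED FORWARD along `Φ`, both
Kummer glues translated by `Φ`, and the two printed quantities are unchanged with NO volume hypothesis —
because `MRData.map` pulls admissibility and log-volume back along `Φ⁻¹`, so translation and pull-back
cancel (abc-iut-c312-1's remark `MRData.map_logvol_image`: "the CONTENT of log-volume invariance is about
comparing `D.logvol (Φ '' A)` with `D.logvol A` for the SAME `D`, not about the transported data").

This file records what the SAME question looks like for two GENUINE settings of one instantiation — the
settings the assembled real construction `Cor312.Setting.ofComparison n …` / `ofComparison n' …`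
(abc-iut-c312-7 at c312-5's request, `Cor312SettingReal.lean`; ADJUDICATION-SPEC §1 "assembled real setting") produces
at two columns from the SAME real-packet pieces `R : RealPieces` (comparison maps `e`, Θ-boxes, q-centres):

* §1 For any two settings with the same hull frames, the same possible images and the same q-images but
  possibly DIFFERENT columns, the two printed quantities agree as soon as the two columns' log-volumes
  agree on the Θ-hulls `^{∘}𝒰_{j,v_ℚ}` and on the q-images (`statement_iff_of_logvol_eq`) — a VOLUME-LEVEL
  hypothesis of exactly Team B's B-2 shape.
* §2 The genuine settings `ofComparison n …` and `ofComparison n' …` over the same pieces have literally the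
  same frames, glues, possible images and hulls (`rfl`): print's hull is taken "relative to the arithmetic
  holomorphic structure labeled `n,∘`" ([IUTchIII] kurims p. 175 l. 1), which in the bi-coric
  strictification (one `LogShells` for all columns, `Thm311Multirad` modelling note) is ONE real frame
  `HullFrame.ofComparison (R.K j v_ℚ) (R.e j v_ℚ)` for every column. Hence, given Thm. 3.11 (i)'s
  `S.D n' = (S.D n).map Φ` with `Φ ∈ indGroup S` (`Situation.multiradialCompat_iff_indGroup`), the
  verbatim `Statement` at column `n'` is equivalent to the one at column `n` PROVIDED the generator-level
  admissibility transport + `MRData.LogvolInvariant` of `S.D n` hold (`ofComparison_statement_iff_of_map`)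
  — i.e. modulo B-2, not definitionally.
* §4 Rider to C-7 (`Cor312QTwist.lean`): the printed local q-contribution is `≤` the log-volume of the hull
  of the union of the q-image's `indGroup`-orbit (`qLocal_le_logvol_hull_qOrbit`, under monotonicity of
  log-volume on admissible regions) — subjecting the q-pilot to (Ind1), (Ind2) the way the Θ-pilot is
  subjected could only RAISE `−|log(q)|`; the exemption (p. 174 l. 8–10) selects the weaker inequality.
* §3 The contrast with C-3, as data: `(P.recolumn n' Φ hD).frame` is the `Φ`-PUSHFORWARD frame (`rfl`),
  whose hull-sets are the `Φ`-images of `P`'s (`HullFrame.pushforward_hul`), whereas the genuine column-`n'`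
  setting keeps `P`'s frame; the two coincide exactly when `Φ` permutes the real hull-sets `e ⁻¹' (λ·𝒪_L)`.
  So "which column carries the comparison is immaterial, no volume invariance consumed" (C-3 headline) is
  a statement about the transported setting; for the genuine settings of a real instantiation the column
  change costs B-2 (this file) — consistent with the C-3 row text of `HOME/plan/C312-TEAMS.md` ("+ the B-2
  invariances (consume, not re-prove)").

Print loci (own render, kurims `paper:url-4b091feeb646`): Cor. 3.12 statement p. 174 l. 4–19; proof p. 174
l. 50 – p. 175 l. 4 (hulls "relative to the arithmetic holomorphic structure labeled `n,∘`"); Step (x)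
p. 181 l. 2–5 ("the resulting log-volumes ∈ ℝ are invariant with respect to the indeterminacies (Ind1),
(Ind2)"); Step (xi-b) p. 181 ("`(^{0,∘}𝒰^ℚ ⊇) ^{0,∘}𝒰 ⥲ ^{1,∘}𝒰 (⊆ ^{1,∘}𝒰^ℚ)` — where the isomorphism arises from
the permutation symmetries discussed in the final portion of Theorem 3.11, (i)"). [claim: Mochizuki2012,
status: disputed] for the quoted clauses; every proof below is bookkeeping [folklore]. Nothing here asserts
`MultiradialCompat`, `LogvolInvariant`, or Cor. 3.12; typed ≠ proved.
-/

noncomputable section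

namespace Summit.ABC.IUTFork.Cor312

open Thm311 Literature.IUT.LogThetaLattice

namespace ColumnGenuine

variable {T : ThetaIndex} {S : Situation T}

/-! ## 1. Cross-column congruence: same frames, same images, volume agreement on the relevant regions -/

section CrossColumn

variable (P P' : Setting S)
  (hframe : ∀ j vQ, P'.frame j vQ = P.frame j vQ)
  (hpi : ∀ j vQ, P'.possibleImages j vQ = P.possibleImages j vQ)

include hframe hpi

/-- Same frames and possible images ⇒ same `HullDefined` (no column hypothesis). [folklore] -/
theorem hullDefined_iff (j : T.Label) (vQ : T.VQ) : P'.HullDefined j vQ ↔ P.HullDefined j vQ := by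
  unfold Setting.HullDefined
  rw [hframe j vQ, hpi j vQ]

/-- Same frames and possible images ⇒ same Θ-hull `^{∘}𝒰_{j,v_ℚ}` as a SUBSET (no column hypothesis).
[folklore] -/
theorem thetaHull_eq (j : T.Label) (vQ : T.VQ) : P'.thetaHull j vQ = P.thetaHull j vQ := by
  unfold Setting.thetaHull
  rw [hframe j vQ, hpi j vQ]

/-- **Cross-column Θ-congruence.** If, in addition, the column-`P'.n` log-volume of each DEFINED Θ-hull
equals its column-`P.n` log-volume, the local Θ-contributions agree. [folklore] -/
theorem thetaLocal_eq_of_logvol_eq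
    (hvol : ∀ j vQ, P.HullDefined j vQ →
      (S.D P'.n).logvol j vQ (P.thetaHull j vQ) = (S.D P.n).logvol j vQ (P.thetaHull j vQ))
    (j : T.Label) (vQ : T.VQ) : P'.thetaLocal j vQ = P.thetaLocal j vQ := by
  have hd := hullDefined_iff P P' hframe hpi j vQ
  have hh := thetaHull_eq P P' hframe hpi j vQ
  unfold Setting.thetaLocal
  by_cases h : P.HullDefined j vQ
  · rw [if_pos h, if_pos (hd.mpr h), hh, hvol j vQ h]
  · rw [if_neg h, if_neg fun hc => h (hd.mp hc)]

/-- Cross-column congruence of the finiteness clause `ThetaFinite`. [folklore] -/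
theorem thetaFinite_iff_of_logvol_eq
    (hvol : ∀ j vQ, P.HullDefined j vQ →
      (S.D P'.n).logvol j vQ (P.thetaHull j vQ) = (S.D P.n).logvol j vQ (P.thetaHull j vQ)) :
    P'.ThetaFinite ↔ P.ThetaFinite := by
  have hl : P'.thetaLocal = P.thetaLocal :=
    funext fun j => funext fun vQ => thetaLocal_eq_of_logvol_eq P P' hframe hpi hvol j vQ
  unfold Setting.ThetaFinite
  rw [hl]

/-- **Cross-column congruence of `−|log(Θ)|`** under volume agreement on the defined Θ-hulls. [folklore] -/
theorem negLogTheta_eq_of_logvol_eq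
    (hvol : ∀ j vQ, P.HullDefined j vQ →
      (S.D P'.n).logvol j vQ (P.thetaHull j vQ) = (S.D P.n).logvol j vQ (P.thetaHull j vQ)) :
    P'.negLogTheta = P.negLogTheta := by
  have hl : P'.thetaLocal = P.thetaLocal :=
    funext fun j => funext fun vQ => thetaLocal_eq_of_logvol_eq P P' hframe hpi hvol j vQ
  have hf := thetaFinite_iff_of_logvol_eq P P' hframe hpi hvol
  unfold Setting.negLogTheta
  by_cases h : P.ThetaFinite
  · rw [if_pos h, if_pos (hf.mpr h), hl]
  · rw [if_neg h, if_neg fun hc => h (hf.mp hc)]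

omit hframe hpi in
/-- **Cross-column congruence of `−|log(q)|`**: same q-images and volume agreement on them. [folklore] -/
theorem negLogQ_eq_of_logvol_eq (hq : ∀ j vQ, P'.qRegion j vQ = P.qRegion j vQ)
    (hvolq : ∀ j vQ, (S.D P'.n).logvol j vQ (P.qRegion j vQ) = (S.D P.n).logvol j vQ (P.qRegion j vQ)) :
    P'.negLogQ = P.negLogQ := by
  unfold Setting.negLogQ Setting.qLocal
  congr 1
  funext i
  exact finsum_congr fun vQ => by rw [hq, hvolq]

/-- **Cross-column congruence of the printed conclusion**: two settings with the same frames, possible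
images and q-images, at columns whose log-volumes agree on the defined Θ-hulls and on the q-images,
satisfy Cor. 3.12's `Statement` together or not at all. The volume hypotheses are exactly what separates
this from the same-column congruence `Setting.statement_congr` of row C-1. [folklore] -/
theorem statement_iff_of_logvol_eq (hq : ∀ j vQ, P'.qRegion j vQ = P.qRegion j vQ)
    (hvol : ∀ j vQ, P.HullDefined j vQ →
      (S.D P'.n).logvol j vQ (P.thetaHull j vQ) = (S.D P.n).logvol j vQ (P.thetaHull j vQ))
    (hvolq : ∀ j vQ, (S.D P'.n).logvol j vQ (P.qRegion j vQ) = (S.D P.n).logvol j vQ (P.qRegion j vQ)) :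
    P'.Statement ↔ P.Statement := by
  unfold Setting.Statement
  rw [negLogTheta_eq_of_logvol_eq P P' hframe hpi hvol, negLogQ_eq_of_logvol_eq P P' hq hvolq]

end CrossColumn

/-! ## 2. The genuine settings of a real instantiation at two columns -/

section Real

open Setting

variable (n n' : ℤ) {HT : Type} {LogLink : HT → HT → Type} {IsFull : ∀ {s t : HT}, LogLink s t → Prop}
  (lat : LGPGaussianLogThetaLattice LogLink IsFull)
  {Frd : Type} {IsoF : Frd → Frd → Type} {Ob : Frd → Type} {realify : Frd → Frd} {Strip : Type}
  {IsoS : Strip → Strip → Type} {M : ∀ v : T.V, v ∈ T.Vbad → Type} [∀ v h, Monoid (M v h)]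
  (sig : GlobalLGPFrobenioidSignature T.lstar T.V (· ∈ T.Vbad) Frd IsoF Ob realify Strip IsoS M)
  (split : SplittingMonoids M) {ObΔ : Type} {N : ∀ v : T.V, v ∈ T.Vbad → Type} [∀ v h, Monoid (N v h)]
  (qData : QPilotData ObΔ N) (R : RealPieces S (Ob sig.Clgp) ObΔ)
  (hq : ∀ j vQ i, R.qCentre (qPilotObject qData) j vQ i ≠ 0)
  (hadm : ∀ j vQ (H : Set (∀ i, R.K j vQ i)), Literature.IUT.LogVolume.IsHullSet (R.K j vQ) H →
    (S.D n).Adm j vQ (R.e j vQ ⁻¹' H))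
  (hfin : ∀ j : T.Label, (Function.support fun vQ => (S.D n).logvol j vQ
    (R.e j vQ ⁻¹' Literature.IUT.LogVolume.hullSet (R.K j vQ) (R.qCentre (qPilotObject qData) j vQ))).Finite)
  (hadm' : ∀ j vQ (H : Set (∀ i, R.K j vQ i)), Literature.IUT.LogVolume.IsHullSet (R.K j vQ) H →
    (S.D n').Adm j vQ (R.e j vQ ⁻¹' H))
  (hfin' : ∀ j : T.Label, (Function.support fun vQ => (S.D n').logvol j vQ
    (R.e j vQ ⁻¹' Literature.IUT.LogVolume.hullSet (R.K j vQ) (R.qCentre (qPilotObject qData) j vQ))).Finite)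

/-- The genuine settings at columns `n` and `n'` over the same real pieces have THE SAME hull frame — the
real frame `λ·𝒪_L` pulled back along the comparison map — not a pushforward of one another. [folklore] -/
theorem ofComparison_frame_eq (j : T.Label) (vQ : T.VQ) :
    (ofComparison n' lat sig split qData R hq hadm' hfin').frame j vQ =
      (ofComparison n lat sig split qData R hq hadm hfin).frame j vQ := rfl

/-- … the same q-pilot image … [folklore] -/
theorem ofComparison_qRegion_eq (j : T.Label) (vQ : T.VQ) :
    (ofComparison n' lat sig split qData R hq hadm' hfin').qRegion j vQ =
      (ofComparison n lat sig split qData R hq hadm hfin).qRegion j vQ := rfl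

/-- … the same Kummer images of the Θ-pilot at every `m` … [folklore] -/
theorem ofComparison_thetaRegion_eq (m : ℤ) (j : T.Label) (vQ : T.VQ) :
    (ofComparison n' lat sig split qData R hq hadm' hfin').thetaRegion m j vQ =
      (ofComparison n lat sig split qData R hq hadm hfin).thetaRegion m j vQ := rfl

/-- … hence the same possible images … [folklore] -/
theorem ofComparison_possibleImages_eq (j : T.Label) (vQ : T.VQ) :
    (ofComparison n' lat sig split qData R hq hadm' hfin').possibleImages j vQ =
      (ofComparison n lat sig split qData R hq hadm hfin).possibleImages j vQ := rfl

/-- … and the same Θ-hulls `^{∘}𝒰_{j,v_ℚ}` as subsets of the packet. [folklore] -/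
theorem ofComparison_thetaHull_eq (j : T.Label) (vQ : T.VQ) :
    (ofComparison n' lat sig split qData R hq hadm' hfin').thetaHull j vQ =
      (ofComparison n lat sig split qData R hq hadm hfin).thetaHull j vQ := rfl

/-- The Θ-hull of the genuine setting, when defined, is admissible for the column's data. [folklore] -/
theorem ofComparison_thetaHull_adm {j : T.Label} {vQ : T.VQ}
    (h : (ofComparison n lat sig split qData R hq hadm hfin).HullDefined j vQ) :
    (S.D n).Adm j vQ ((ofComparison n lat sig split qData R hq hadm hfin).thetaHull j vQ) :=
  (ofComparison n lat sig split qData R hq hadm hfin).thetaHull_adm h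

/-- The q-image of the genuine setting is admissible for the column's data. [folklore] -/
theorem ofComparison_qRegion_adm (j : T.Label) (vQ : T.VQ) :
    (S.D n).Adm j vQ ((ofComparison n lat sig split qData R hq hadm hfin).qRegion j vQ) :=
  (ofComparison n lat sig split qData R hq hadm hfin).hul_adm j vQ _
    ((ofComparison n lat sig split qData R hq hadm hfin).qRegion_mem j vQ)

/-- **GENUINE COLUMN CHANGE COSTS B-2.** For the genuine settings of one real instantiation at columns
`n` and `n'` (same real pieces), Thm. 3.11 (i)'s étale-picture compatibility in the form
`S.D n' = (S.D n).map Φ`, `Φ ∈ indGroup S`, gives `Statement` at `n'` ↔ `Statement` at `n` PROVIDED the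
generating indeterminacy families transport admissibility and `S.D n` satisfies `MRData.LogvolInvariant`
(Step (x), p. 181 l. 2–5 — Team B's B-2 targets on the real containers): the column-`n'` volume of a region
`A` is the column-`n` volume of `Φ⁻¹ '' A` (definition of `MRData.map`), and `Φ⁻¹ ∈ indGroup` preserves the
column-`n` volume of the ADMISSIBLE regions `thetaHull`, `qRegion` (L6-t13/c312-1's closure propagation
`MRData.adm_and_logvol_eq_of_mem_closure`). Contrast: C-3's `recolumn_statement_iff` needs no B-2 because its
column-`n'` setting carries the `Φ`-pushforward frame and `Φ`-translated glues (§3). [folklore] -/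
theorem ofComparison_statement_iff_of_map (Φ : S.L.PacketAut) (hΦ : Φ ∈ Setting.indGroup S)
    (hD : S.D n' = (S.D n).map Φ)
    (hAdm : ∀ Ψ ∈ S.L.Ind1Family ∪ S.L.Ind2Family, ∀ (j : T.Label) (vQ : T.VQ)
      (A : Set (S.L.Packet j vQ)), (S.D n).Adm j vQ A ↔ (S.D n).Adm j vQ (Ψ j vQ '' A))
    (hvol : (S.D n).LogvolInvariant) :
    (ofComparison n' lat sig split qData R hq hadm' hfin').Statement ↔
      (ofComparison n lat sig split qData R hq hadm hfin).Statement := by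
  have hinv : Φ⁻¹ ∈ Setting.indGroup S := (Setting.indGroup S).inv_mem hΦ
  -- the column-`n'` volume of `A` is the column-`n` volume of `Φ⁻¹ '' A`
  have hread : ∀ (j : T.Label) (vQ : T.VQ) (A : Set (S.L.Packet j vQ)),
      (S.D n').logvol j vQ A = (S.D n).logvol j vQ (Φ⁻¹ j vQ '' A) := by
    intro j vQ A
    rw [hD]
    rfl
  refine statement_iff_of_logvol_eq
    (ofComparison n lat sig split qData R hq hadm hfin) (ofComparison n' lat sig split qData R hq hadm' hfin')
    (fun _ _ => rfl) (fun _ _ => rfl) (fun _ _ => rfl) ?_ ?_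
  · intro j vQ hdef
    show (S.D n').logvol j vQ _ = (S.D n).logvol j vQ _
    rw [hread]
    exact ((S.D n).adm_and_logvol_eq_of_mem_closure hAdm hvol hinv j vQ _
      (ofComparison_thetaHull_adm n lat sig split qData R hq hadm hfin hdef)).2
  · intro j vQ
    show (S.D n').logvol j vQ _ = (S.D n).logvol j vQ _
    rw [hread]
    exact ((S.D n).adm_and_logvol_eq_of_mem_closure hAdm hvol hinv j vQ _
      (ofComparison_qRegion_adm n lat sig split qData R hq hadm hfin j vQ)).2

/-- Under Thm. 3.11 (i) as typed (`Situation.MultiradialCompat`, a HYPOTHESIS) and B-2 at column `n`, the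
genuine settings at ALL columns satisfy the statement together or not at all. [folklore] -/
theorem ofComparison_statement_iff_of_multiradialCompat (hMR : S.MultiradialCompat)
    (hAdm : ∀ Ψ ∈ S.L.Ind1Family ∪ S.L.Ind2Family, ∀ (j : T.Label) (vQ : T.VQ)
      (A : Set (S.L.Packet j vQ)), (S.D n).Adm j vQ A ↔ (S.D n).Adm j vQ (Ψ j vQ '' A))
    (hvol : (S.D n).LogvolInvariant) :
    (ofComparison n' lat sig split qData R hq hadm' hfin').Statement ↔
      (ofComparison n lat sig split qData R hq hadm hfin).Statement := by
  obtain ⟨Φ, hΦ, hD⟩ := (Situation.multiradialCompat_iff_indGroup S).mp hMR n n'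
  exact ofComparison_statement_iff_of_map n n' lat sig split qData R hq hadm hfin hadm' hfin' Φ hΦ hD hAdm hvol

/-- **… and B-2's real criterion discharges exactly those hypotheses.** Composing with TEAM B's landed
single-Haar-container criterion (`MRData.ind_adm_iff_and_logvolInvariant_of_latticeRealisations`,
`Cor312IndVolumeReal.lean`, abc-iut-c312-12: log-volume and admissibility of the column-`n` data read through
maps into containers with normalised Haar measures, every (Ind1)/(Ind2) generator realised by an additive
homeomorphism fixing some integral structure — Dupuy–Hilado §4.7/§4.9): under those realisation hypotheses
at column `n` and `S.D n' = (S.D n).map Φ`, `Φ ∈ indGroup S`, the genuine settings at `n'` and `n` satisfy the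
statement together. Nothing is asserted about whether the realisation hypotheses hold for a given
instantiation (Team B's A-0/B-2 real rows). [folklore] -/
theorem ofComparison_statement_iff_of_latticeRealisations (Φ : S.L.PacketAut)
    (hΦ : Φ ∈ Setting.indGroup S) (hD : S.D n' = (S.D n).map Φ)
    {W : T.Label → T.VQ → Type} [∀ j vQ, AddCommGroup (W j vQ)] [∀ j vQ, TopologicalSpace (W j vQ)]
    [∀ j vQ, IsTopologicalAddGroup (W j vQ)] [∀ j vQ, MeasurableSpace (W j vQ)] [∀ j vQ, BorelSpace (W j vQ)]
    (Λ : ∀ j vQ, Literature.IUT.LogVolume.IntegralStructure (W j vQ)) (d : T.Label → T.VQ → ℕ)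
    (c : ∀ (j : T.Label) (vQ : T.VQ), S.L.Packet j vQ → W j vQ)
    (hlogvol : ∀ (j : T.Label) (vQ : T.VQ) (A : Set (S.L.Packet j vQ)),
      (S.D n).logvol j vQ A = (Λ j vQ).normalizedLogVolume (d j vQ) (c j vQ '' A))
    (hAdmC : ∀ (j : T.Label) (vQ : T.VQ) (A : Set (S.L.Packet j vQ)),
      (S.D n).Adm j vQ A ↔ 0 < (Λ j vQ).haar (c j vQ '' A) ∧ (Λ j vQ).haar (c j vQ '' A) < ⊤)
    (hInd : ∀ Ψ : S.L.PacketAut, (Ψ ∈ S.L.Ind1Family ∨ Ψ ∈ S.L.Ind2Family) → ∀ (j : T.Label) (vQ : T.VQ),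
      ∃ (ψ : W j vQ ≃ₜ+ W j vQ) (Λ₀ : Literature.IUT.LogVolume.IntegralStructure (W j vQ)),
        ψ '' (Λ₀ : Set (W j vQ)) = (Λ₀ : Set (W j vQ)) ∧ ∀ x, c j vQ (Ψ j vQ x) = ψ (c j vQ x)) :
    (ofComparison n' lat sig split qData R hq hadm' hfin').Statement ↔
      (ofComparison n lat sig split qData R hq hadm hfin).Statement := by
  obtain ⟨hAdm, hvol⟩ :=
    (S.D n).ind_adm_iff_and_logvolInvariant_of_latticeRealisations Λ d c hlogvol hAdmC hInd
  exact ofComparison_statement_iff_of_map n n' lat sig split qData R hq hadm hfin hadm' hfin' Φ hΦ hD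
    hAdm hvol

/-! ## 3. The contrast with C-3's transported setting, as data -/

/-- The hull-sets of a pushed-forward frame are the images of the original hull-sets. [folklore] -/
theorem pushforward_hul {X Y : Type} (F : HullFrame X) (e : X ≃ Y) :
    (F.pushforward e).Hul = (Set.image ⇑e) '' F.Hul := rfl

/-- C-3's transport of the genuine column-`n` setting to column `n'` carries the `Φ`-PUSHFORWARD frame …
[folklore] -/
theorem recolumn_ofComparison_frame (Φ : S.L.PacketAut) (hD : S.D n' = (S.D n).map Φ)
    (j : T.Label) (vQ : T.VQ) :
    ((ofComparison n lat sig split qData R hq hadm hfin).recolumn n' Φ hD).frame j vQ =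
      (HullFrame.ofComparison (R.K j vQ) (R.e j vQ)).pushforward (Φ j vQ).toEquiv := rfl

/-- … whereas the genuine column-`n'` setting carries the SAME real frame as column `n`. The two frames have
the same hull-sets iff `Φ j v_ℚ` permutes the pulled-back real hull-sets `e ⁻¹' (λ·𝒪_L)` — a property of the
instantiated indeterminacy families (for the capsule permutations of (Ind1) it holds whenever `e`
intertwines them with ring automorphisms of `⊕ K`; for a general isometry of the log-shell it is not given
by the types). [folklore] -/
theorem ofComparison_frame_at (j : T.Label) (vQ : T.VQ) :
    (ofComparison n' lat sig split qData R hq hadm' hfin').frame j vQ =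
      HullFrame.ofComparison (R.K j vQ) (R.e j vQ) := rfl

/-- The criterion in set form: the transported frame has the genuine hull-sets iff `Φ j v_ℚ` maps the family
of real hull-sets onto itself. [folklore] -/
theorem recolumn_hul_eq_iff (Φ : S.L.PacketAut) (hD : S.D n' = (S.D n).map Φ) (j : T.Label) (vQ : T.VQ) :
    (((ofComparison n lat sig split qData R hq hadm hfin).recolumn n' Φ hD).frame j vQ).Hul =
        ((ofComparison n' lat sig split qData R hq hadm' hfin').frame j vQ).Hul ↔
      (Set.image ⇑(Φ j vQ)) '' (HullFrame.ofComparison (R.K j vQ) (R.e j vQ)).Hul =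
        (HullFrame.ofComparison (R.K j vQ) (R.e j vQ)).Hul := Iff.rfl

end Real

/-! ## 4. Rider to C-7: measuring the q-pilot "subject to" the indeterminacies could only RAISE `−|log(q)|` -/

section QOrbit

variable (P : Setting S)

/-- The identity family moves no subset of a packet. [folklore] -/
theorem one_apply_image (j : T.Label) (vQ : T.VQ) (A : Set (S.L.Packet j vQ)) :
    (1 : S.L.PacketAut) j vQ '' A = A := by
  have h : (⇑((1 : S.L.PacketAut) j vQ) : S.L.Packet j vQ → S.L.Packet j vQ) = id := by
    funext x; rfl
  rw [h, Set.image_id]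

/-- The q-pilot image lies in the union of its `indGroup`-orbit — the family that WOULD be "the possible
images of the q-pilot object" if the statement subjected the q-pilot to (Ind1), (Ind2) the way it subjects
the Θ-pilot (whose `possibleImages` is the `indGroup`-orbit of `thetaRegion3`, `Cor312Statement.lean`); the
printed statement does NOT ("which we do *not* regard as subject to", p. 174 l. 8–10). [folklore] -/
theorem qRegion_subset_sUnion_qOrbit (j : T.Label) (vQ : T.VQ) :
    P.qRegion j vQ ⊆ ⋃₀ {U | ∃ Φ ∈ Setting.indGroup S, U = Φ j vQ '' P.qRegion j vQ} := fun _ hx =>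
  Set.mem_sUnion.2 ⟨P.qRegion j vQ,
    ⟨1, (Setting.indGroup S).one_mem, (one_apply_image (S := S) j vQ _).symm⟩, hx⟩

/-- **The q-exemption selects the weaker inequality.** If log-volumes at `(j, v_ℚ)` are monotone on
admissible regions (the `(j, v_ℚ)`-instance of c312-6's `Cor312Vol.LogvolMono`) and the holomorphic hull of
the q-orbit-union is admissible, then the printed local q-contribution `qLocal` (log-volume of the SINGLE
q-image, a hull-set) is `≤` the log-volume of the hull of the union of the q-image's `indGroup`-translates —
the quantity the Θ-side recipe (orbit, union, hull: p. 174 l. 50 – p. 175 l. 1) would assign to the q-pilot.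
So at the level of the two numbers the statement's exemption of the q-pilot from (Ind1), (Ind2) LOWERS the
right-hand side `−|log(q)|` of `−|log(q)| ≤ −|log(Θ)|`; what row C-7 (`qTwistGlue_statement_iff_of_invariance`)
shows to be immaterial, given B-2, is the choice of REPRESENTATIVE of the q-image inside its orbit (for
representatives that are again hull-sets), not the orbit-hull enlargement. [folklore] -/
theorem qLocal_le_logvol_hull_qOrbit (j : T.Label) (vQ : T.VQ)
    (hmono : ∀ A B : Set (S.L.Packet j vQ), (S.D P.n).Adm j vQ A → (S.D P.n).Adm j vQ B → A ⊆ B →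
      (S.D P.n).logvol j vQ A ≤ (S.D P.n).logvol j vQ B)
    (hadm : (S.D P.n).Adm j vQ ((P.frame j vQ).hull
      (⋃₀ {U | ∃ Φ ∈ Setting.indGroup S, U = Φ j vQ '' P.qRegion j vQ}))) :
    P.qLocal j vQ ≤ (S.D P.n).logvol j vQ ((P.frame j vQ).hull
      (⋃₀ {U | ∃ Φ ∈ Setting.indGroup S, U = Φ j vQ '' P.qRegion j vQ})) :=
  hmono _ _ (P.hul_adm j vQ _ (P.qRegion_mem j vQ)) hadm
    ((qRegion_subset_sUnion_qOrbit P j vQ).trans ((P.frame j vQ).subset_hull _))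

end QOrbit

end ColumnGenuine

end Summit.ABC.IUTFork.Cor312

end
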